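import Literature.NumberTheory.EllipticCurves.ModularSymbolsPeriodHomology
import HarnessLib.Audit
import HarnessLib

/-!
# Route `ResidualThetaTransportAtTwo` — definition file: the curve-free spanning statement (G′)_N at `p = 2`
# («the closed loops `{0 → b/4^k}` span `ker(H₁(X₀(N); 𝔽₂) → Q_N ⊗ 𝔽₂)`», dual form)

Cell `bsd-wall`, lead `bsd-wall-rtt-p4` g5, crux Kμ⁺ `SignedMuVanishingAtTwoPlus` (stmt-BirchSwinnertonDyer-20689). ONE definition
(a predicate of the level `N`; no instance, no notation, nothing asserted) naming the HYPOTHESIS of the landed kernel chain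
`…SignedMuVanishingAtTwoPlusCuspSpanHeckeShimura` / `…CuspSpanHecke` / `…CuspSpanFlat` (p592546 / p592862 / p593268), where it is
spelled inline: `CuspSpanEvenAtTwo N` is VERBATIM the binder `hG` of `SignedMuAtTwo.exists_odd_re_cuspSymbol_of_cuspSpan` and of
`SignedMuAtTwo.flatAtTwo_of_cuspSpan` (so `flatAtTwo_of_cuspSpan hf hss ha (h : CuspSpanEvenAtTwo (W.conductorNorm ℤ))` typechecks by
`Iff.rfl`-unfolding), and `∀ N, ¬ 2 ∣ N → CuspSpanEvenAtTwo N` is the binder of `SignedMuAtTwo.flatMuZeroAtTwo_of_cuspSpan`.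

MEANING (lead g4's `Cruxes/SignedMuVanishingAtTwoPlus/FlatCuspSpan.md` §§2–3, dualised; `CuspSpanKernel.md`): every additive
`ZMod 2`-valued function `χ` on `Γ₀(N)` that factors through the period homology `H₁(X₀(N); ℤ) ⊂ S₂(Γ₀(N))^∧` (`periodFunctional`;
so `χ ∈ H¹(X₀(N); 𝔽₂)`) and kills every `γ` whose lower-right entry is `±4^k`, `k ≥ 1` (the closed loops `{0 → b/4^k}`, `b` odd),
is of the form `ψ ∘ d` with `ψ : ZMod N → ZMod 2` multiplicative on units (i.e. comes from the Shimura quotient `(ℤ/N)^× / ±1`).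
Equivalently (finite-dimensional duality; `V ⊆ K` always since `4^k` is a square mod `N`): `V^even_N := span{[{0 → b/4^k}]}` EQUALS
`K_N := ker(H₁(X₀(N); 𝔽₂) → Q_N ⊗ 𝔽₂)`, `Q_N = (ℤ/N)^×/⟨−1, d(parabolics), d(elliptics)⟩`.

STATUS: an `f`-free, curve-free, FINITE statement per level; verified by exact `𝔽₂`-linear algebra (two independent codes: lead g4's
`cuspspan2.py`, lead g5's `cuspspan_g5.py`) for every odd `N ≤ 2999` with `g(X₀(N)) ≥ 1` and for the habitat⁺ conductors 11475, 14157,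
35131, 42085, 50745 (kit jobs j295333 / j296726 for all 147 habitat⁺ conductors); OPEN for infinite families — for all odd `N` it implies
Perrin-Riou–Pollack's `μ⁻ = 0` at `p = 2` for every weight-2 newform with `a₂ ∈ {0, ±2}` and irreducible `ρ̄₂` (open, cf. arXiv:2409.18021).
NOT a theorem of the literature and not asserted here: a definition only. BSD is not proved by this.

References: B. Mazur, *Modular curves and the Eisenstein ideal*, Publ. IHÉS 47 (1977) §II.11 (Shimura subgroup) [Mazur1977];
S. Ling, J. Oesterlé, *The Shimura subgroup of `J₀(N)`*, Astérisque 196–197 (1991) [LingOesterle1991]; R. Pollack, Duke Math. J. 118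
(2003) Conj. 6.3 [Pollack2003]; J. E. Cremona, *Algorithms for modular elliptic curves* (1997) §2.1–2.5 [CremonaAlgorithms1997].
-/

set_option autoImplicit false
set_option linter.dupNamespace false

noncomputable section

open scoped MatrixGroups

open CongruenceSubgroup Literature.NumberTheory.EllipticCurves.ModularForms

namespace Summit.BirchSwinnertonDyer.BirchSwinnertonDyer.Theorems.SignedMuAtTwo

/-- **(G′)_N, dual form** (the even `2`-power cusp classes span the kernel of the Shimura-quotient map on `H₁(X₀(N); 𝔽₂)`):
every `χ : Γ₀(N) → ZMod 2` which is additive, factors through the period functionals `γ ↦ (h ↦ {∞, γ∞}_h)` and vanishes on every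
`γ` with lower-right entry of absolute value `4^k`, `k ≥ 1`, is `ψ ∘ (lower-right entry)` for some `ψ : ZMod N → ZMod 2`
multiplicative on units. A finite, curve-free statement about `X₀(N)`; hypothesis of `flatAtTwo_of_cuspSpan` (verbatim); open in
general, verified for the listed levels (see the module docstring). Definition only — nothing is asserted.
(CONJECTURE-grade per level; `@[conjecture]`, nothing asserted.) -/
@[conjecture] def CuspSpanEvenAtTwo (N : ℕ) [NeZero N] : Prop :=
  ∀ χ : Gamma0 N → ZMod 2,
    (∀ γ δ : Gamma0 N, χ (γ * δ) = χ γ + χ δ) →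
    (∀ γ δ : Gamma0 N, periodFunctional N γ = periodFunctional N δ → χ γ = χ δ) →
    (∀ γ : Gamma0 N, (∃ k : ℕ, 1 ≤ k ∧ ((γ : SL(2, ℤ)) 1 1).natAbs = 4 ^ k) → χ γ = 0) →
    ∃ ψ : ZMod N → ZMod 2, (∀ x y : ZMod N, IsUnit x → IsUnit y → ψ (x * y) = ψ x + ψ y) ∧
      ∀ γ : Gamma0 N, χ γ = ψ ((((γ : SL(2, ℤ)) 1 1 : ℤ) : ZMod N))

/-- Unfolding `CuspSpanEvenAtTwo` (definitional; this is how the inline hypothesis `hG` of `flatAtTwo_of_cuspSpan` /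
`exists_odd_re_cuspSymbol_of_cuspSpan` is discharged from the named statement). [folklore] -/
theorem cuspSpanEvenAtTwo_iff (N : ℕ) [NeZero N] :
    CuspSpanEvenAtTwo N ↔ ∀ χ : Gamma0 N → ZMod 2,
      (∀ γ δ : Gamma0 N, χ (γ * δ) = χ γ + χ δ) →
      (∀ γ δ : Gamma0 N, periodFunctional N γ = periodFunctional N δ → χ γ = χ δ) →
      (∀ γ : Gamma0 N, (∃ k : ℕ, 1 ≤ k ∧ ((γ : SL(2, ℤ)) 1 1).natAbs = 4 ^ k) → χ γ = 0) →
      ∃ ψ : ZMod N → ZMod 2, (∀ x y : ZMod N, IsUnit x → IsUnit y → ψ (x * y) = ψ x + ψ y) ∧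
        ∀ γ : Gamma0 N, χ γ = ψ ((((γ : SL(2, ℤ)) 1 1 : ℤ) : ZMod N)) :=
  Iff.rfl

/-- The zero character always satisfies the conclusion (so (G′)_N is a statement about the NON-trivial classes killing the
`4^k`-loops): `ψ = 0` is multiplicative on units. [folklore] -/
theorem cuspSpanEvenAtTwo_conclusion_zero (N : ℕ) [NeZero N] :
    ∃ ψ : ZMod N → ZMod 2, (∀ x y : ZMod N, IsUnit x → IsUnit y → ψ (x * y) = ψ x + ψ y) ∧
      ∀ γ : Gamma0 N, (fun _ : Gamma0 N ↦ (0 : ZMod 2)) γ = ψ ((((γ : SL(2, ℤ)) 1 1 : ℤ) : ZMod N)) :=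
  ⟨fun _ ↦ 0, fun _ _ _ _ ↦ by simp, fun _ ↦ rfl⟩

end Summit.BirchSwinnertonDyer.BirchSwinnertonDyer.Theorems.SignedMuAtTwo

end
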